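import Summits.AtomisticToContinuum.BoseEinsteinCondensation.Theorems.BECConjugateDominationDefs
import Summits.AtomisticToContinuum.BoseEinsteinCondensation.Theorems.InfraredMinimumUncertainty.Negative.FreeMinimisersConstant

/-!
# Route `BECConjugateDomination`, crux `InfraredMinimumUncertainty` (stmt-AtomisticToContinuum-11784):
# vocabulary of the line `tilted-coherence-work-variance`

Route-posited objects (D-0016 `<Route>Defs` file) shared by the four registered stubs of the skeleton
`Cruxes/InfraredMinimumUncertainty/Lines/tilted_coherence_work_variance.lean` (crux-plan gen 1, round 2;
stubs `stub_tiltedLevyIdentity`, `stub_tiltedGeneratorIdentity`, `stub_tiltStability`,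
`stub_bridgeVarianceCeiling`, registered on stmt-AtomisticToContinuum-11784) and by the crux file that
composes them.  Supports (does not close) stmt-AtomisticToContinuum-11784.  Nothing is asserted: the two
`def … : Prop` below (`TiltedGeneratorIdentityAt`, `TiltedMinimumUncertainty`) are *statements* (the
conclusion of stub S2, consumed as a hypothesis by S3/S4; and the line's transfer `C⁺`), consumed only as
the type of a stub theorem or as an explicit hypothesis of a glue lemma.  Bodies are the skeleton's,
verbatim (themselves the ideator's farm-checked `Cruxes/InfraredMinimumUncertainty/IdeatorSketch_r2_k4.lean`).

The line (idea card `Cruxes/InfraredMinimumUncertainty/Ideas/tilted-coherence-work-variance.md`, line card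
`Lines/tilted-coherence-work-variance.md`): the Lévy weight `ν_m = Re ĉ_m(log g)` of the crux is the one
non-quadratic object (a Fourier coefficient of a LOGARITHM).  Thermodynamic integration along the
geometric interpolation `Φ_t = Ψ^{1-t}(Ψ∘τ_r)^t` between a positive state and its one-particle translate
(`τ_r X = (x₀ + r, x₁, …, x_n)`) removes the logarithm exactly: with the displacement WORK
`δU_r = log Ψ − log Ψ∘τ_r` and the tilted probability measures `μ_t ∝ Φ_t² dX`,
`ψ_r(t) := log ∫ Ψ^{2(1-t)}(Ψ∘τ_r)^{2t}` is convex, `ψ_r(0) = ψ_r(1) = 0`, `ψ_r(½) = log g(r)`,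
`ψ_r'' = 4 Var_{μ_t}(δU_r)`, whence `log g(r) = −2 ∫₀¹ min(t,1−t) · Var_{μ_t}(δU_r) dt` and
`N·ν_m·S_m = ∫₀¹ 4 min(t,1−t) Π_t(m) dt` with `Π_t(m) := −N S_m V̂_t(m)/2`,
`V̂_t(m) := Re ĉ_m[r ↦ Var_{μ_t^{(r)}}(δU_r)]`.

Objects (units `ħ = 2m = 1`, torus vocabulary of `PeriodicBoseGas.lean` / `PeriodicBoseGasFourier.lean`,
crux vocabulary `coherence` / `levyWeight` / `structureFactor` of `Theorems/BECConjugateDominationDefs.lean`):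

* `shiftFirst r X = τ_r X` — shift of the tagged particle `0` by `r`;
* `work Ψ r X = δU_r(X) = log |Ψ(X)| − log |Ψ(τ_r X)|` — the displacement work;
* `tiltWeight Ψ t r X = |Ψ(X)|^{2(1−t)} |Ψ(τ_r X)|^{2t} = Φ_t(X)²` — unnormalised density of `μ_t`;
* `tiltNorm Ψ t r = φ_r(t) = ∫_{cell^N} Φ_t²` (`φ_r(0) = φ_r(1) = 1`, `φ_r(½) = g(r)`);
* `tiltMean Ψ t r = E_{μ_t}[δU_r]`, `tiltVar Ψ t r = Var_{μ_t}(δU_r)` (`= ψ_r''(t)/4`);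
* `tiltVarCoeff n L Ψ t m = V̂_t(m)` — the cell Fourier profile of the work variance;
* `tiltedProduct n L Ψ t m = Π_t(m) = −N · S_m · V̂_t(m) / 2` — the `t`-resolved uncertainty product;
* `TiltedGeneratorIdentityAt v Ψ` — the weak generator identity of the tilt family (statement; S2's
  conclusion): `∫ (∇η · ∇δU_r) Φ_t² = ∫ η · [(W∘τ_r − W) − (1 − 2t)|∇δU_r|²] Φ_t²` for all
  `t ∈ [0,1]`, `r`, and `C¹` periodic real `η`;
* `TiltedMinimumUncertainty` — the transfer `C⁺` (statement): `Π_t(m) ≤ C` for every tilt.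

Positive control at `v ≡ 0` (Disproof §E `body_zero`, `Negative/FreeMinimisersConstant`): free
minimisers are constants, so the work, its variance and every `Π_t(m)` vanish
(`work_eq_zero_of_const`, `tiltVar_eq_zero_of_const`, `tiltedProduct_eq_zero_of_free_minimiser`) —
consistent with `C = 0`.

References: the line card; C. Jarzynski, Phys. Rev. Lett. 78 (1997) 2690 and G. E. Crooks, Phys. Rev.
E 60 (1999) 2721 (work / thermodynamic-integration identities along an interpolation of measures);
W. L. McMillan, Phys. Rev. 138 (1965) A442 (ratio/overlap sampling of `Ψ·Ψ∘τ_r`); C. Mora, Y. Castin,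
Phys. Rev. A 67 (2003) 053615 §4.3 (Lévy weight of `log g₁`).
-/

noncomputable section

open MeasureTheory Filter Set
open scoped ENNReal NNReal Topology BigOperators

namespace Summit.AtomisticToContinuum.BoseEinsteinCondensation.Cruxes.InfraredMinimumUncertainty.TiltedCoherenceWorkVariance

open Literature.MathematicalPhysics.QuantumManyBody.BoseGas
open Summit.AtomisticToContinuum.BoseEinsteinCondensation.Cruxes.InfraredMinimumUncertainty.FisherGaussianDensityMode
  (InSmoothClass IsPositiveMinimiser structureFactor)
open Summit.AtomisticToContinuum.BoseEinsteinCondensation.Theorems.InfraredMinimumUncertainty.Negative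
  (exists_eq_const_of_free_minimiser)

variable {n : ℕ} {L : ℝ}

/-! ## The objects of the line (bodies = the skeleton's, verbatim) -/

/-- Shift of the tagged particle (index `0`) by `r`: `τ_r X = (x₀ + r, x₁, …, x_n)`
(`= Matrix.vecCons (x + r) Y` for `X = Matrix.vecCons x Y`, the crux's `g`). -/
def shiftFirst (r : Space) (X : Config (n + 1)) : Config (n + 1) :=
  Function.update X 0 (X 0 + r)

/-- The displacement WORK `δU_r(X) = log |Ψ(X)| − log |Ψ(τ_r X)|` (`Ψ = e^{−U}` positive:
`δU_r = U∘τ_r − U`). -/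
def work (Ψ : PeriodicTrialState (n + 1) L) (r : Space) (X : Config (n + 1)) : ℝ :=
  Real.log ‖Ψ.ψ X‖ - Real.log ‖Ψ.ψ (shiftFirst r X)‖

/-- The tilt weight `|Ψ(X)|^{2(1−t)} |Ψ(τ_r X)|^{2t} = Φ_t(X)²` of the geometric interpolation
`Φ_t = Ψ^{1−t}(Ψ∘τ_r)^t` (unnormalised density of `μ_t`; `t = 0`: `|Ψ|²`, `t = 1`: `|Ψ∘τ_r|²`,
`t = ½`: `|Ψ||Ψ∘τ_r|`). -/
def tiltWeight (Ψ : PeriodicTrialState (n + 1) L) (t : ℝ) (r : Space) (X : Config (n + 1)) : ℝ :=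
  ‖Ψ.ψ X‖ ^ (2 * (1 - t)) * ‖Ψ.ψ (shiftFirst r X)‖ ^ (2 * t)

/-- `φ_r(t) = ∫_{cell^N} |Ψ|^{2(1−t)} |Ψ∘τ_r|^{2t}` (`φ_r(0) = φ_r(1) = 1`, `φ_r(½) = g(r)`). -/
def tiltNorm (Ψ : PeriodicTrialState (n + 1) L) (t : ℝ) (r : Space) : ℝ :=
  ∫ X in cellN (n + 1) L, tiltWeight Ψ t r X

/-- `E_{μ_t}[δU_r]` (`= −ψ_r'(t)/2`; `0` at `t = ½` by the reflection `Ψ ↔ Ψ∘τ_r`). -/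
def tiltMean (Ψ : PeriodicTrialState (n + 1) L) (t : ℝ) (r : Space) : ℝ :=
  (tiltNorm Ψ t r)⁻¹ * ∫ X in cellN (n + 1) L, tiltWeight Ψ t r X * work Ψ r X

/-- `Var_{μ_t}(δU_r)` — the WORK VARIANCE under the tilted state (`= ψ_r''(t)/4`). -/
def tiltVar (Ψ : PeriodicTrialState (n + 1) L) (t : ℝ) (r : Space) : ℝ :=
  (tiltNorm Ψ t r)⁻¹ * ∫ X in cellN (n + 1) L, tiltWeight Ψ t r X * (work Ψ r X - tiltMean Ψ t r) ^ 2

/-- `V̂_t(m) = Re ĉ_m[r ↦ Var_{μ_t^{(r)}}(δU_r)]` — the cell Fourier PROFILE of the work variance. -/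
def tiltVarCoeff (n : ℕ) (L : ℝ) (Ψ : PeriodicTrialState (n + 1) L) (t : ℝ) (m : Fin 3 → ℤ) : ℝ :=
  (cellFourierCoeff L (fun r : Space => ((tiltVar Ψ t r : ℝ) : ℂ)) m).re

/-- The `t`-resolved minimum-uncertainty product `Π_t(m) := −N · S_m · V̂_t(m) / 2`
(so that `Π_m = ∫₀¹ 4 min(t,1−t) Π_t(m) dt` by S1; Bogoliubov/harmonic order: `Π_t(m) = (1−S_m)²/4`
for every `t`). -/
def tiltedProduct (n : ℕ) (L : ℝ) (Ψ : PeriodicTrialState (n + 1) L) (t : ℝ) (m : Fin 3 → ℤ) : ℝ :=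
  -(((n : ℝ) + 1) * structureFactor n L Ψ m * tiltVarCoeff n L Ψ t m) / 2

/-- **The tilted generator identity for `(v, Ψ)`** (the conclusion of S2, consumed as a HYPOTHESIS by
S3 and S4): for every tilt `t ∈ [0,1]`, every displacement `r` and every `C¹`, `Lℤ³`-periodic real
test function `η` on configuration space (NO Bose symmetry required),
`∫ (∇η · ∇δU_r) Φ_t² dX = ∫ η · [(W∘τ_r − W) − (1 − 2t)|∇δU_r|²] Φ_t² dX`
(`W = (∑_{i<j} v^per(xᵢ−xⱼ)).toReal`), i.e. `−L_t δU_r = (W∘τ_r − W) − (1−2t)|∇δU_r|²` weakly for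
the generator `L_t = Δ − 2∇U_t·∇` of `μ_t ∝ Φ_t² dX`.  At `t = ½`: the BRIDGE POISSON IDENTITY
`−L_½ δU_r = W∘τ_r − W`.  A statement (about `v`, `Ψ`), not a fact. -/
def TiltedGeneratorIdentityAt (v : ℝ → ℝ≥0∞) {n : ℕ} {L : ℝ} (Ψ : PeriodicTrialState (n + 1) L) :
    Prop :=
  ∀ t ∈ Set.Icc (0 : ℝ) 1, ∀ r : Space, ∀ η : Config (n + 1) → ℝ, ContDiff ℝ 1 η →
    (∀ (X : Config (n + 1)) (i : Fin (n + 1)) (k : Fin 3),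
        η (X + Pi.single i (EuclideanSpace.single k L)) = η X) →
    (∫ X in cellN (n + 1) L,
        (∑ i : Fin (n + 1), ∑ k : Fin 3,
            fderiv ℝ η X (Pi.single i (EuclideanSpace.single k (1 : ℝ))) *
              fderiv ℝ (work Ψ r) X (Pi.single i (EuclideanSpace.single k (1 : ℝ)))) *
          tiltWeight Ψ t r X) =
      ∫ X in cellN (n + 1) L,
        η X *
            (((periodicInteraction v L (shiftFirst r X)).toReal - (periodicInteraction v L X).toReal) -
              (1 - 2 * t) *
                ∑ i : Fin (n + 1), ∑ k : Fin 3,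
                  fderiv ℝ (work Ψ r) X (Pi.single i (EuclideanSpace.single k (1 : ℝ))) ^ 2) *
          tiltWeight Ψ t r X

/-! ## Positive control at `v ≡ 0` (cf. `pi_eq_zero_of_free_minimiser`, Disproof §E `body_zero`) -/

/-- For a constant state the work vanishes identically. -/
theorem work_eq_zero_of_const (Ψ : PeriodicTrialState (n + 1) L) {c : ℂ} (hc : ∀ X, Ψ.ψ X = c)
    (r : Space) (X : Config (n + 1)) : work Ψ r X = 0 := by
  simp [work, hc]

/-- For a constant state the work variance vanishes identically (every tilt, every `r`). -/
theorem tiltVar_eq_zero_of_const (Ψ : PeriodicTrialState (n + 1) L) {c : ℂ} (hc : ∀ X, Ψ.ψ X = c)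
    (t : ℝ) (r : Space) : tiltVar Ψ t r = 0 := by
  have hw : ∀ X, work Ψ r X = 0 := work_eq_zero_of_const Ψ hc r
  have hm : tiltMean Ψ t r = 0 := by simp [tiltMean, hw]
  simp [tiltVar, hw, hm]

/-- **`v ≡ 0` is consistent with `C = 0` at EVERY tilt**: the minimisers of the free periodic energy
are the constants (`exists_eq_const_of_free_minimiser`, Negative/FreeMinimisersConstant), so
`Π_t(m) = 0` for every `t`, `m` — the tilted analogue of `pi_eq_zero_of_free_minimiser`. -/
theorem tiltedProduct_eq_zero_of_free_minimiser (hL : 0 < L) (Ψ : PeriodicTrialState (n + 1) L)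
    (hE : periodicEnergy 0 Ψ = periodicGroundStateEnergy 0 (n + 1) L) (t : ℝ) (m : Fin 3 → ℤ) :
    tiltedProduct n L Ψ t m = 0 := by
  obtain ⟨c, hc⟩ := exists_eq_const_of_free_minimiser hL Ψ hE
  have hV : tiltVarCoeff n L Ψ t m = 0 := by
    unfold tiltVarCoeff
    simp only [tiltVar_eq_zero_of_const Ψ hc, Complex.ofReal_zero]
    rw [cellFourierCoeff_eq_integral hL]
    simp
  simp [tiltedProduct, hV]

/-- **Positive control, registered form** (sub-goal `tiltedProduct_free_control` of
stmt-AtomisticToContinuum-11784, through which this vocabulary file lands `--supports`; precedent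
`BECConjugateDominationDefs.stub_imuOfParts`): for `v ≡ 0` and `L > 0` every minimiser of the free
periodic energy has `Π_t(m) = 0` at every tilt `t` and every mode `m` (the line is consistent with
`C = 0` at `v ≡ 0`, as the crux is: Disproof §E `body_zero`). -/
theorem tiltedProduct_free_control :
    ∀ (n : ℕ) (L : ℝ), 0 < L → ∀ Ψ : PeriodicTrialState (n + 1) L,
      periodicEnergy 0 Ψ = periodicGroundStateEnergy 0 (n + 1) L →
        ∀ (t : ℝ) (m : Fin 3 → ℤ), tiltedProduct n L Ψ t m = 0 :=
  fun _n _L hL Ψ hE t m => tiltedProduct_eq_zero_of_free_minimiser hL Ψ hE t m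

/-! ## The transfer `C⁺` of the line (a statement, not a fact) -/

/-- **`TiltedMinimumUncertainty` — the card's TRANSFER `C⁺`** (strictly stronger than the crux,
which is its `4min(t,1−t)dt`-average): for every smooth-class `v` there are `C ≥ 0`, `ρ₀ > 0` such
that for `0 < ρ < ρ₀`, eventually in `N = n+1`, every positive minimiser, every `m ≠ 0` and EVERY
tilt `t ∈ [0,1]`: `Π_t(m) ≤ C`.  Not registered as a stub (the skeleton CUTS it into
S3 ∧ S4 given S2 and proves `C⁺ ∧ S1 ⇒` the crux).  A statement, not a fact. -/
def TiltedMinimumUncertainty : Prop :=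
  ∀ v : ℝ → ℝ≥0∞, InSmoothClass v → ∃ C : ℝ, 0 ≤ C ∧ ∃ ρ₀ : ℝ, 0 < ρ₀ ∧
    ∀ ρ : ℝ, 0 < ρ → ρ < ρ₀ → ∀ᶠ n : ℕ in atTop,
      ∀ Ψ : PeriodicTrialState (n + 1) (sideLength ρ (n + 1)), IsPositiveMinimiser v Ψ →
        ∀ m : Fin 3 → ℤ, m ≠ 0 → ∀ t ∈ Set.Icc (0 : ℝ) 1,
          tiltedProduct n (sideLength ρ (n + 1)) Ψ t m ≤ C

end Summit.AtomisticToContinuum.BoseEinsteinCondensation.Cruxes.InfraredMinimumUncertainty.TiltedCoherenceWorkVariance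

end
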